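import Summits.MatrixMultiplication.OmegaCensus.ThreeSetZ5Z5CoverKitE
import HarnessLib

/-!
# The THREE-margin kernel enumerator on `ZMod p × ZMod p` with an exception list

ω-census `pub-omega`, family (b3), seat pub-omega-group gen 37.  Framing: lottery ticket; floor = certified bounds/negative
ranges.  VALUE: kernel infrastructure sized for the `ℤ₅²` stage of the last engine-only cell of order `325`, the domino cell `(1,9,12)@325`
(`HOME/pub-omega-group-g37/DESIGN-1-9-12.md`: two-margin enumeration `≈ 6–7.5·10⁵` leaves per hole, three-margin `≈ 10⁵`); NOT progress on ω.

`ThreeSetZ5Z5CoverKitE.cover3E` (gen 37) draws the rows of a count matrix `g` (row sums = direction `0`) bounded by the remaining COLUMN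
capacities (direction `1`).  Here a third capacity vector is carried for direction `2` (`u ↦ u₁ + u₂`; cell `(t, u)` of row `t` lies in class
`pv p 2 (t·p + u)`): a candidate row is placed only if its class sums fit the remaining direction-`2` capacities (`fitsD`), and the outer
program ranges over the flagged (row, column, diagonal) count-vector triples only.
* `rowClassSum`, `fitsD`, `subCapD`, `diagIdx p` (class indices per row); `rowsEnumE3` / `rowsEnumE3_spec`; `coverGenE3` / `coverGenE3_spec`;
* `cover3E3 p d tree exc` and **`exists_unflagged_or_exc_of_cover3E3`**, **`exists_cert_or_exc_of_cover3E3`** — the same conclusions as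
  `cover3E`: a direction `j ≤ p` with `cert j (cnts p j g)` (given `soundChk3`), OR `rowsOf g ∈ exc`.
Nothing about `tree` or `exc` is trusted.
-/

namespace Summit.MatrixMultiplication.OmegaCensus

open Finset

namespace ZpZpDomino

/-! ## Direction-`2` bookkeeping -/

/-- Sum of the entries of `row` whose class index (listed in `ds`) is `k`. [folklore] -/
def rowClassSum (ds row : List ℕ) (k : ℕ) : ℕ :=
  ((List.range row.length).map fun u => if ds.getD u 0 = k then row.getD u 0 else 0).sum

/-- The row fits the remaining class capacities. [folklore] -/
def fitsD (capD ds row : List ℕ) : Bool :=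
  (List.range capD.length).all fun k => decide (rowClassSum ds row k ≤ capD.getD k 0)

/-- Remaining class capacities after placing a row. [folklore] -/
def subCapD (capD ds row : List ℕ) : List ℕ := (List.range capD.length).map fun k => capD.getD k 0 - rowClassSum ds row k

/-- Length of `subCapD`. [folklore] -/
@[simp] theorem length_subCapD (capD ds row : List ℕ) : (subCapD capD ds row).length = capD.length := by simp [subCapD]

/-- Entries of `subCapD`. [folklore] -/
theorem getD_subCapD (capD ds row : List ℕ) {k : ℕ} (hk : k < capD.length) :
    (subCapD capD ds row).getD k 0 = capD.getD k 0 - rowClassSum ds row k := by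
  simp [subCapD, List.getD_eq_getElem?_getD, List.getElem?_range hk]

/-- Class indices of direction `2` for the cells of row `t`: `pv p 2 (t·p + u)`, `u < p`. [folklore] -/
def diagIdx (p : ℕ) : List (List ℕ) := (List.range p).map fun t => (List.range p).map fun u => pv p 2 (t * p + u)

/-- A `List.range` map-sum is a `Finset.range` sum. [folklore] -/
theorem sum_map_range_eq (f : ℕ → ℕ) : ∀ n : ℕ, ((List.range n).map f).sum = ∑ i ∈ range n, f i
  | 0 => by simp
  | n + 1 => by rw [List.range_succ, List.map_append, List.sum_append, sum_range_succ, sum_map_range_eq f n]; simp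

/-! ## The row enumerator with three margins and exceptions -/

/-- Rows with prescribed sums `R`, bounded by the remaining column capacities `cap` AND the remaining direction-`2` capacities `capD`
(class indices per row in `dss`), carrying the rows placed so far; a leaf passes if some accumulated code is unflagged or the matrix is
listed in `exc`. [folklore] -/
def rowsEnumE3 (tree : BTree) (exc : List (List (List ℕ))) :
    List (List (List ℕ)) → List (List ℕ) → List ℕ → List ℕ → List ℕ → List ℕ → List (List ℕ) → Bool
  | w :: ws, ds :: dss, r :: R, cap, capD, accs, pre =>
      (compsUB cap r).all fun row => !(fitsD capD ds row) ||
        rowsEnumE3 tree exc ws dss R (subCap cap row) (subCapD capD ds row) (addRow w accs row) (pre ++ [row])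
  | _, _, _, _, _, accs, pre => (accs.any fun a => !(tree.mem a)) || exc.any fun e => e == pre

/-- **Specification of the three-margin row enumerator**: every matrix with row sums `R`, rows of length `cap.length`, column sums
bounded by `cap` and direction-`2` class sums (per `dss`) bounded by `capD` reaches a passing leaf. [folklore] -/
theorem rowsEnumE3_spec (tree : BTree) (exc : List (List (List ℕ))) : ∀ (ws : List (List (List ℕ))) (dss : List (List ℕ))
    (R cap capD accs : List ℕ) (pre : List (List ℕ)),
    rowsEnumE3 tree exc ws dss R cap capD accs pre = true → ws.length = R.length → dss.length = R.length →
    ∀ M : List (List ℕ), M.length = R.length →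
    (∀ t < R.length, (M.getD t []).length = cap.length ∧ (M.getD t []).sum = R.getD t 0) →
    (∀ k < cap.length, (∑ t ∈ range R.length, (M.getD t []).getD k 0) ≤ cap.getD k 0) →
    (∀ k < capD.length, (∑ t ∈ range R.length, rowClassSum (dss.getD t []) (M.getD t []) k) ≤ capD.getD k 0) →
    ((accsAfter ws accs M).any (fun a => !(tree.mem a)) || exc.any fun e => e == pre ++ M) = true
  | [], dss, [], cap, capD, accs, pre, h, _, _, M, hM, _, _, _ => by
    have hM' : M = [] := List.eq_nil_of_length_eq_zero hM
    subst hM'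
    cases dss <;> simpa [rowsEnumE3, accsAfter] using h
  | [], _, _ :: _, _, _, _, _, _, hl, _, _, _, _, _, _ => by simp at hl
  | _ :: _, _, [], _, _, _, _, _, hl, _, _, _, _, _, _ => by simp at hl
  | _ :: _, [], _ :: _, _, _, _, _, _, _, hd, _, _, _, _, _ => by simp at hd
  | w :: ws, ds :: dss, r :: R, cap, capD, accs, pre, h, hl, hd, M, hM, hrows, hcols, hdiag => by
    obtain ⟨row, M', rfl⟩ := List.exists_cons_of_length_eq_add_one hM
    simp only [rowsEnumE3, List.all_eq_true] at h
    simp only [List.length_cons, Nat.add_right_cancel_iff] at hl hd hM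
    have h0 := hrows 0 (by simp)
    simp only [List.getD_cons_zero] at h0
    have hrowcap : ∀ k < cap.length, row.getD k 0 ≤ cap.getD k 0 := fun k hk => by
      have hc := hcols k hk
      rw [List.length_cons, sum_range_succ'] at hc
      simp only [List.getD_cons_zero, List.getD_cons_succ] at hc
      omega
    have hrowD : ∀ k < capD.length, rowClassSum ds row k ≤ capD.getD k 0 := fun k hk => by
      have hc := hdiag k hk
      rw [List.length_cons, sum_range_succ'] at hc
      simp only [List.getD_cons_zero, List.getD_cons_succ] at hc
      omega
    have hmem : row ∈ compsUB cap r := mem_compsUB cap r row h0.1 h0.2 hrowcap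
    have hfit : fitsD capD ds row = true := by
      simp only [fitsD, List.all_eq_true, List.mem_range, decide_eq_true_eq]
      exact hrowD
    have hrec := h row hmem
    rw [hfit, Bool.not_true, Bool.false_or] at hrec
    simp only [accsAfter]
    have happ : pre ++ row :: M' = (pre ++ [row]) ++ M' := by simp
    rw [happ]
    refine rowsEnumE3_spec tree exc ws dss R (subCap cap row) (subCapD capD ds row) _ _ hrec hl hd M' hM (fun t ht => ?_)
      (fun k hk => ?_) (fun k hk => ?_)
    · have h1 := hrows (t + 1) (by simpa using ht)
      simp only [List.getD_cons_succ] at h1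
      rw [length_subCap _ _ h0.1]
      exact h1
    · rw [length_subCap _ _ h0.1] at hk
      rw [getD_subCap _ _ h0.1 hk]
      have hc := hcols k hk
      rw [List.length_cons, sum_range_succ'] at hc
      simp only [List.getD_cons_zero, List.getD_cons_succ] at hc
      omega
    · rw [length_subCapD] at hk
      rw [getD_subCapD _ _ _ hk]
      have hc := hdiag k hk
      rw [List.length_cons, sum_range_succ'] at hc
      simp only [List.getD_cons_zero, List.getD_cons_succ] at hc
      omega

/-- **The three-margin cover program with exceptions**: over row-sum vectors `R`, column-sum vectors `C` and direction-`2` vectors `D`,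
either one of the three codes is unflagged or the enumeration passes. [folklore] -/
def coverGenE3 (tree : BTree) (exc : List (List (List ℕ))) (B : ℕ) (ws : List (List (List ℕ))) (dss : List (List ℕ))
    (Rlist Clist Dlist : List (List ℕ)) (init : List ℕ) (offC offD : ℕ) : Bool :=
  Rlist.all fun R => !(tree.mem (polyBE B R)) ||
    Clist.all fun C => !(tree.mem (offC + polyBE B C)) ||
      Dlist.all fun D => !(tree.mem (offD + polyBE B D)) || rowsEnumE3 tree exc ws dss R C D init []

/-- **Specification of the three-margin cover program.** [folklore] -/
theorem coverGenE3_spec {tree : BTree} {exc : List (List (List ℕ))} {B : ℕ} {ws : List (List (List ℕ))} {dss : List (List ℕ)}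
    {Rlist Clist Dlist : List (List ℕ)} {init : List ℕ} {offC offD : ℕ}
    (h : coverGenE3 tree exc B ws dss Rlist Clist Dlist init offC offD = true)
    (R : List ℕ) (hR : R ∈ Rlist) (hRl : ws.length = R.length) (hRd : dss.length = R.length) (C : List ℕ) (hC : C ∈ Clist)
    (D : List ℕ) (hD : D ∈ Dlist) :
    tree.mem (polyBE B R) = false ∨ tree.mem (offC + polyBE B C) = false ∨ tree.mem (offD + polyBE B D) = false ∨
      ∀ M : List (List ℕ), M.length = R.length →
        (∀ t < R.length, (M.getD t []).length = C.length ∧ (M.getD t []).sum = R.getD t 0) →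
        (∀ k < C.length, (∑ t ∈ range R.length, (M.getD t []).getD k 0) ≤ C.getD k 0) →
        (∀ k < D.length, (∑ t ∈ range R.length, rowClassSum (dss.getD t []) (M.getD t []) k) ≤ D.getD k 0) →
        ((accsAfter ws init M).any (fun a => !(tree.mem a)) || exc.any fun e => e == M) = true := by
  simp only [coverGenE3, List.all_eq_true] at h
  have hR' := h R hR
  rcases Bool.or_eq_true_iff.1 hR' with h1 | h2
  · left; simpa using h1
  · rw [List.all_eq_true] at h2
    rcases Bool.or_eq_true_iff.1 (h2 C hC) with h3 | h4
    · right; left; simpa using h3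
    · rw [List.all_eq_true] at h4
      rcases Bool.or_eq_true_iff.1 (h4 D hD) with h5 | h6
      · right; right; left; simpa using h5
      · right; right; right
        intro M hM hrows hcols hdiag
        have := rowsEnumE3_spec tree exc ws dss R C D init [] h6 hRl hRd M hM hrows hcols hdiag
        simpa using this

/-- **The three-margin three-set cover program with exceptions** (directions `0, 1, 2` as margins). [folklore] -/
def cover3E3 (p d : ℕ) (tree : BTree) (exc : List (List (List ℕ))) : Bool :=
  coverGenE3 tree exc (d + 1) (rowWs p (d + 1)) (diagIdx p) (compsLB [] p d) (compsLB [] p d) (compsLB [] p d) (offs p (d + 1))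
    (off p (d + 1) 1) (off p (d + 1) 2)

/-! ## Semantics -/

section Semantic

variable {p : ℕ} [NeZero p]

omit [NeZero p] in
/-- Rows of `diagIdx`. [folklore] -/
theorem getD_diagIdx {t : ℕ} (ht : t < p) : (diagIdx p).getD t [] = (List.range p).map fun u => pv p 2 (t * p + u) := by
  simp [diagIdx, List.getD_eq_getElem?_getD, List.getElem?_range ht]

omit [NeZero p] in
/-- The class sum of row `t` of `rowsOf g` (direction `2`) as a `pick`-sum over the cells of that row. [folklore] -/
theorem rowClassSum_rowsOf (g : Fin (p * p) → ℕ) (t : Fin p) (k : ℕ) :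
    rowClassSum ((diagIdx p).getD t.val []) ((rowsOf g).getD t.val []) k = ∑ u : Fin p, pick k (pv p 2 (cell t u).val) (g (cell t u)) := by
  rw [rowClassSum, getD_rowsOf g t.isLt, List.length_ofFn, sum_map_range_eq, ← Fin.sum_univ_eq_sum_range]
  refine Fintype.sum_congr _ _ fun u => ?_
  rw [getD_diagIdx t.isLt, Literature.Computability.Complexity.getD_ofFn _ _ u.isLt, cell_val]
  have e : (List.map (fun u => pv p 2 (t.val * p + u)) (List.range p)).getD u.val 0 = pv p 2 (t.val * p + u.val) := by
    simp [List.getD_eq_getElem?_getD]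
  rw [e]
  unfold pick
  by_cases h : pv p 2 (t.val * p + u.val) = k
  · simp only [if_pos h]
  · simp only [if_neg h]

omit [NeZero p] in
/-- The count vector of direction `2` bounds (indeed equals) the class sums of the rows. [folklore] -/
theorem sum_rowClassSum_le (g : Fin (p * p) → ℕ) (k : ℕ) (hk : k < p) :
    (∑ t ∈ range p, rowClassSum ((diagIdx p).getD t []) ((rowsOf g).getD t []) k) ≤ (cnts p 2 g).getD k 0 := by
  rw [getD_cnts 2 g hk, sum_eq_sum_cell, sum_range]
  exact le_of_eq (Fintype.sum_congr _ _ fun t => rowClassSum_rowsOf g t k)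

/-- **From the three-margin cover program to an unflagged tagged code or a listed exception.** [folklore] -/
theorem exists_unflagged_or_exc_of_cover3E3 (hp : 2 ≤ p) {d : ℕ} (tree : BTree) (exc : List (List (List ℕ)))
    (h : cover3E3 p d tree exc = true) (g : Fin (p * p) → ℕ) (hg : ∑ i, g i = d) :
    (∃ j < p + 1, tree.mem (off p (d + 1) j + polyBE (d + 1) (cnts p j g)) = false) ∨ rowsOf g ∈ exc := by
  have hp0 : 0 < p := Nat.pos_of_ne_zero (NeZero.ne p)
  have hRlen : (rowSums g).length = p := length_rowSums g
  have hRsum : (rowSums g).sum = d := by rw [sum_rowSums, hg]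
  have hRmem : rowSums g ∈ compsLB [] p d := mem_compsLB [] p d _ hRlen hRsum fun k _ => by simp
  have hCmem : cnts p 1 g ∈ compsLB [] p d := hg ▸ cnts_mem_compsLB 1 g
  have hDmem : cnts p 2 g ∈ compsLB [] p d := hg ▸ cnts_mem_compsLB 2 g
  have hdl : (diagIdx p).length = (rowSums g).length := by simp [diagIdx, hRlen]
  rcases coverGenE3_spec h _ hRmem (by rw [length_rowWs, hRlen]) hdl _ hCmem _ hDmem with hR | hC | hD | hM
  · exact Or.inl ⟨0, by omega, by rw [cnts_zero_eq_rowSums, off_zero, zero_add]; exact hR⟩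
  · exact Or.inl ⟨1, by omega, hC⟩
  · exact Or.inl ⟨2, by omega, hD⟩
  · have hrows : ∀ t < (rowSums g).length,
        ((rowsOf g).getD t []).length = (cnts p 1 g).length ∧ ((rowsOf g).getD t []).sum = (rowSums g).getD t 0 := by
      intro t ht
      rw [hRlen] at ht
      rw [getD_rowsOf g ht, length_cnts, List.length_ofFn, List.sum_ofFn, getD_rowSums g ht]
      exact ⟨rfl, rfl⟩
    have hcols : ∀ k < (cnts p 1 g).length,
        (∑ t ∈ range (rowSums g).length, ((rowsOf g).getD t []).getD k 0) ≤ (cnts p 1 g).getD k 0 := by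
      intro k hk
      rw [length_cnts] at hk
      rw [hRlen, getD_cnts 1 g hk, sum_range, sum_pick_one g ⟨k, hk⟩]
      refine le_of_eq (Fintype.sum_congr _ _ fun t => ?_)
      rw [getD_rowsOf g t.isLt, Literature.Computability.Complexity.getD_ofFn _ _ hk]
    have hdiag : ∀ k < (cnts p 2 g).length,
        (∑ t ∈ range (rowSums g).length, rowClassSum ((diagIdx p).getD t []) ((rowsOf g).getD t []) k) ≤ (cnts p 2 g).getD k 0 := by
      intro k hk
      rw [length_cnts] at hk
      rw [hRlen]
      exact sum_rowClassSum_le g k hk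
    have hany := hM (rowsOf g) (by rw [length_rowsOf, hRlen]) hrows hcols hdiag
    rcases Bool.or_eq_true_iff.1 hany with hany | hexc
    · left
      rw [List.any_eq_true] at hany
      obtain ⟨a, ha, hfa⟩ := hany
      obtain ⟨j, hj, rfl⟩ := List.getElem_of_mem ha
      have hws : ∀ w ∈ rowWs p (d + 1), ∀ x ∈ w, x.length = (offs p (d + 1)).length := by
        intro w hw x hx
        simp only [rowWs, List.mem_map, List.mem_range] at hw
        obtain ⟨t, -, rfl⟩ := hw
        simp only [rowW, List.mem_map, List.mem_range] at hx
        obtain ⟨u, -, rfl⟩ := hx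
        simp
      have hlen : (accsAfter (rowWs p (d + 1)) (offs p (d + 1)) (rowsOf g)).length = p + 1 := by
        rw [length_accsAfter _ _ _ hws, length_offs]
      have hj' : j < p + 1 := by rw [← hlen]; exact hj
      refine ⟨j, hj', ?_⟩
      have e := getD_accsAfter_rowsOf_init (d + 1) g (offs p (d + 1)) (length_offs _ _) hj'
      rw [List.getD_eq_getElem _ _ hj, getD_offs _ _ hj', code_eq_polyBE] at e
      rw [← e]
      simpa using hfa
    · right
      rw [List.any_eq_true] at hexc
      obtain ⟨e, he, hee⟩ := hexc
      rw [beq_iff_eq] at hee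
      rw [← hee]; exact he

/-- **From the three-margin cover program and the soundness check to a certified direction or a listed exception.** [folklore] -/
theorem exists_cert_or_exc_of_cover3E3 (hp : 2 ≤ p) {d : ℕ} (tree : BTree) (exc : List (List (List ℕ)))
    (cert : ℕ → List ℕ → Bool) (hs : soundChk3 p d tree cert = true) (h : cover3E3 p d tree exc = true)
    (g : Fin (p * p) → ℕ) (hg : ∑ i, g i = d) :
    (∃ j < p + 1, cert j (cnts p j g) = true) ∨ rowsOf g ∈ exc := by
  rcases exists_unflagged_or_exc_of_cover3E3 hp tree exc h g hg with ⟨j, hj, hmem⟩ | hexc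
  · left
    refine ⟨j, hj, ?_⟩
    simp only [soundChk3, List.all_eq_true, List.mem_range] at hs
    have h1 := hs j hj (cnts p j g) (hg ▸ cnts_mem_compsLB j g)
    rw [hmem, Bool.false_or] at h1
    exact h1
  · exact Or.inr hexc

end Semantic

section Chunked

variable {p : ℕ} [NeZero p]

/-! ## Chunked / filtered outer lists (each kernel computation must stay small) -/

/-- **Filtered form**: the outer lists need only contain the FLAGGED row / column / diagonal vectors (any lists `Rlist`, `Clist`, `Dlist`
with that property, e.g. one flagged row vector per theorem); the conclusion of `exists_unflagged_or_exc_of_cover3E3` still holds. [folklore] -/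
theorem exists_unflagged_or_exc_of_coverGenE3 (hp : 2 ≤ p) {d : ℕ} (tree : BTree) (exc : List (List (List ℕ)))
    (Rlist Clist Dlist : List (List ℕ))
    (hR : ∀ R ∈ compsLB [] p d, tree.mem (polyBE (d + 1) R) = true → R ∈ Rlist)
    (hC : ∀ C ∈ compsLB [] p d, tree.mem (off p (d + 1) 1 + polyBE (d + 1) C) = true → C ∈ Clist)
    (hD : ∀ D ∈ compsLB [] p d, tree.mem (off p (d + 1) 2 + polyBE (d + 1) D) = true → D ∈ Dlist)
    (h : coverGenE3 tree exc (d + 1) (rowWs p (d + 1)) (diagIdx p) Rlist Clist Dlist (offs p (d + 1)) (off p (d + 1) 1)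
      (off p (d + 1) 2) = true)
    (g : Fin (p * p) → ℕ) (hg : ∑ i, g i = d) :
    (∃ j < p + 1, tree.mem (off p (d + 1) j + polyBE (d + 1) (cnts p j g)) = false) ∨ rowsOf g ∈ exc := by
  have hp0 : 0 < p := Nat.pos_of_ne_zero (NeZero.ne p)
  have hRlen : (rowSums g).length = p := length_rowSums g
  have hRsum : (rowSums g).sum = d := by rw [sum_rowSums, hg]
  have hRmem : rowSums g ∈ compsLB [] p d := mem_compsLB [] p d _ hRlen hRsum fun k _ => by simp
  have hCmem : cnts p 1 g ∈ compsLB [] p d := hg ▸ cnts_mem_compsLB 1 g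
  have hDmem : cnts p 2 g ∈ compsLB [] p d := hg ▸ cnts_mem_compsLB 2 g
  -- if one of the three codes is unflagged we are done at once
  by_cases hR0 : tree.mem (polyBE (d + 1) (rowSums g)) = true
  swap
  · exact Or.inl ⟨0, by omega, by rw [cnts_zero_eq_rowSums, off_zero, zero_add]; simpa using hR0⟩
  by_cases hC0 : tree.mem (off p (d + 1) 1 + polyBE (d + 1) (cnts p 1 g)) = true
  swap
  · exact Or.inl ⟨1, by omega, by simpa using hC0⟩
  by_cases hD0 : tree.mem (off p (d + 1) 2 + polyBE (d + 1) (cnts p 2 g)) = true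
  swap
  · exact Or.inl ⟨2, by omega, by simpa using hD0⟩
  have hdl : (diagIdx p).length = (rowSums g).length := by simp [diagIdx, hRlen]
  rcases coverGenE3_spec h _ (hR _ hRmem hR0) (by rw [length_rowWs, hRlen]) hdl _ (hC _ hCmem hC0) _ (hD _ hDmem hD0)
    with hR' | hC' | hD' | hM
  · exact Or.inl ⟨0, by omega, by rw [cnts_zero_eq_rowSums, off_zero, zero_add]; exact hR'⟩
  · exact Or.inl ⟨1, by omega, hC'⟩
  · exact Or.inl ⟨2, by omega, hD'⟩
  · have hrows : ∀ t < (rowSums g).length,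
        ((rowsOf g).getD t []).length = (cnts p 1 g).length ∧ ((rowsOf g).getD t []).sum = (rowSums g).getD t 0 := by
      intro t ht
      rw [hRlen] at ht
      rw [getD_rowsOf g ht, length_cnts, List.length_ofFn, List.sum_ofFn, getD_rowSums g ht]
      exact ⟨rfl, rfl⟩
    have hcols : ∀ k < (cnts p 1 g).length,
        (∑ t ∈ range (rowSums g).length, ((rowsOf g).getD t []).getD k 0) ≤ (cnts p 1 g).getD k 0 := by
      intro k hk
      rw [length_cnts] at hk
      rw [hRlen, getD_cnts 1 g hk, sum_range, sum_pick_one g ⟨k, hk⟩]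
      refine le_of_eq (Fintype.sum_congr _ _ fun t => ?_)
      rw [getD_rowsOf g t.isLt, Literature.Computability.Complexity.getD_ofFn _ _ hk]
    have hdiag : ∀ k < (cnts p 2 g).length,
        (∑ t ∈ range (rowSums g).length, rowClassSum ((diagIdx p).getD t []) ((rowsOf g).getD t []) k) ≤ (cnts p 2 g).getD k 0 := by
      intro k hk
      rw [length_cnts] at hk
      rw [hRlen]
      exact sum_rowClassSum_le g k hk
    have hany := hM (rowsOf g) (by rw [length_rowsOf, hRlen]) hrows hcols hdiag
    rcases Bool.or_eq_true_iff.1 hany with hany | hexc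
    · left
      rw [List.any_eq_true] at hany
      obtain ⟨a, ha, hfa⟩ := hany
      obtain ⟨j, hj, rfl⟩ := List.getElem_of_mem ha
      have hws : ∀ w ∈ rowWs p (d + 1), ∀ x ∈ w, x.length = (offs p (d + 1)).length := by
        intro w hw x hx
        simp only [rowWs, List.mem_map, List.mem_range] at hw
        obtain ⟨t, -, rfl⟩ := hw
        simp only [rowW, List.mem_map, List.mem_range] at hx
        obtain ⟨u, -, rfl⟩ := hx
        simp
      have hlen : (accsAfter (rowWs p (d + 1)) (offs p (d + 1)) (rowsOf g)).length = p + 1 := by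
        rw [length_accsAfter _ _ _ hws, length_offs]
      have hj' : j < p + 1 := by rw [← hlen]; exact hj
      refine ⟨j, hj', ?_⟩
      have e := getD_accsAfter_rowsOf_init (d + 1) g (offs p (d + 1)) (length_offs _ _) hj'
      rw [List.getD_eq_getElem _ _ hj, getD_offs _ _ hj', code_eq_polyBE] at e
      rw [← e]
      simpa using hfa
    · right
      rw [List.any_eq_true] at hexc
      obtain ⟨e, he, hee⟩ := hexc
      rw [beq_iff_eq] at hee
      rw [← hee]; exact he

/-- **Filtered form with the soundness check**: a certified direction or a listed exception. [folklore] -/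
theorem exists_cert_or_exc_of_coverGenE3 (hp : 2 ≤ p) {d : ℕ} (tree : BTree) (exc : List (List (List ℕ)))
    (Rlist Clist Dlist : List (List ℕ))
    (hR : ∀ R ∈ compsLB [] p d, tree.mem (polyBE (d + 1) R) = true → R ∈ Rlist)
    (hC : ∀ C ∈ compsLB [] p d, tree.mem (off p (d + 1) 1 + polyBE (d + 1) C) = true → C ∈ Clist)
    (hD : ∀ D ∈ compsLB [] p d, tree.mem (off p (d + 1) 2 + polyBE (d + 1) D) = true → D ∈ Dlist)
    (h : coverGenE3 tree exc (d + 1) (rowWs p (d + 1)) (diagIdx p) Rlist Clist Dlist (offs p (d + 1)) (off p (d + 1) 1)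
      (off p (d + 1) 2) = true)
    (cert : ℕ → List ℕ → Bool) (hs : soundChk3 p d tree cert = true) (g : Fin (p * p) → ℕ) (hg : ∑ i, g i = d) :
    (∃ j < p + 1, cert j (cnts p j g) = true) ∨ rowsOf g ∈ exc := by
  rcases exists_unflagged_or_exc_of_coverGenE3 hp tree exc Rlist Clist Dlist hR hC hD h g hg with ⟨j, hj, hmem⟩ | hexc
  · left
    refine ⟨j, hj, ?_⟩
    simp only [soundChk3, List.all_eq_true, List.mem_range] at hs
    have h1 := hs j hj (cnts p j g) (hg ▸ cnts_mem_compsLB j g)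
    rw [hmem, Bool.false_or] at h1
    exact h1
  · exact Or.inr hexc

/-- **Splitting the row list**: the program over `R₁ ++ R₂` is the conjunction of the programs over `R₁` and `R₂` (so the flagged
row vectors may be certified one theorem at a time and reassembled). [folklore] -/
theorem coverGenE3_append (tree : BTree) (exc : List (List (List ℕ))) (B : ℕ) (ws : List (List (List ℕ))) (dss : List (List ℕ))
    (R₁ R₂ Clist Dlist : List (List ℕ)) (init : List ℕ) (offC offD : ℕ) :
    coverGenE3 tree exc B ws dss (R₁ ++ R₂) Clist Dlist init offC offD =
      (coverGenE3 tree exc B ws dss R₁ Clist Dlist init offC offD && coverGenE3 tree exc B ws dss R₂ Clist Dlist init offC offD) := by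
  simp [coverGenE3, List.all_append]

end Chunked

end ZpZpDomino

end Summit.MatrixMultiplication.OmegaCensus
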